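import Summits.ABC.IUTFork.DAGC312p
import Summits.ABC.IUTFork.Cor312GapGlobalCountermodel
import Summits.ABC.IUTFork.Cor312SoundInputPilot

/-!
# Kernel DAG index — layer C312, part u: knitting DELTA 12 — THE ONE NODE LEFT = the cell's gap statements of record, BY NAME

index v1 · abc-iut-c312-2 (filer, gen 3). PROOF-ONLY, APPEND-ONLY (imports part p; the fork skeleton's XXV `ForkInputStrip` via skel's
`Cor312GapGlobalCountermodel`; abc-iut-c312-9's `Cor312SoundInputPilot`). Part p left one undischarged step node, (xi-f), and showed that
under the readings of record it is the typed Corollary (given `ThetaFinite`/`AbsLogQPos`). The 13:00Z adjudication (HOME/plan/ADJUDICATION-SPEC.md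
§1–§2) carries the disputed inference as the GAP STATEMENT OF RECORD at two levels: LEVEL 0 = skel XXV `InputStrip.StripAlgorithm.GapGlobal`
(soundness of the multiradial algorithm at the `q`-pilot input strip; «≡ Statement mod ThetaFinite», `gapGlobal_iff_statement`, p413284) and
A1's pilot-strip reading `Cor312Vol.SoundAtPilot` (`soundAtPilot_iff_statement`, p414839, every setting, every gluing); LEVEL 1 =
`SoundAtInput` (flagged STRONGER-THAN-PRINT). This part records the identifications in the index's currency, so the census reads in one line:
«THE ONE NODE LEFT = GapGlobal (any strip algorithm) = SoundAtPilot (any gluing) = the typed Statement», each `↔` a kernel theorem, given only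
the Corollary's own finiteness clause (and `|log(q)| > 0` where the node's (xi-d)-side display is unfolded):
* `N_IUTchIII_Cor3_12_pf_xi_f_iff_gapGlobal` · `…_iff_soundAtPilot` · `gapGlobal_iff_soundAtPilot` · `xi_f_levels` (the three-way record).
THIS FILE PROVES NOTHING NEW about [IUTchIII] §3 AND ASSERTS NOTHING; no side taken on Cor. 3.12. typed ≠ discharged; indexed ≠ endorsed.
[claim: Mochizuki2012, status: disputed]
-/

noncomputable section

namespace Summit.ABC.IUTFork.DAG

open Cor312Proof Thm311 Cor312Vol InputStrip Literature.IUT.LogThetaLattice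

variable {T : ThetaIndex} (S : FullSituation T) (pending : Locus → Prop) (P : Cor312.Setting S.toSituation)
  (D : ThetaLinkStrips P.LogLink P.Strip)

/-- **THE ONE NODE LEFT = LEVEL 0 (`GapGlobal`)**: for ANY strip algorithm `A` over the setting (skel XXV), given `ThetaFinite` and `AbsLogQPos`,
the (xi-f) node under the readings of record ⟺ `A.GapGlobal` (soundness at the `q`-pilot input strip). BY NAME: part p's
`N_IUTchIII_Cor3_12_pf_xi_f_iff_statement` and skel's `InputStrip.gapGlobal_iff_statement`. [claim: Mochizuki2012, status: disputed] -/
theorem N_IUTchIII_Cor3_12_pf_xi_f_iff_gapGlobal (A : StripAlgorithm P) (hfin : P.ThetaFinite) (hqpos : P.AbsLogQPos) :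
    N_IUTchIII_Cor3_12_pf_xi_f (lociReadingI S pending) (obsReadingA S pending P D) ↔ A.GapGlobal :=
  (N_IUTchIII_Cor3_12_pf_xi_f_iff_statement S pending P D hfin hqpos).trans (gapGlobal_iff_statement A hfin).symm

/-- **THE ONE NODE LEFT = the PILOT-STRIP reading (`SoundAtPilot`)**: for ANY value-group gluing `G` (Team B's `LinkGluing`), given `ThetaFinite`
and `AbsLogQPos`, the (xi-f) node under the readings of record ⟺ `SoundAtPilot P G`. BY NAME: part p + c312-9's `soundAtPilot_iff_statement`.
[claim: Mochizuki2012, status: disputed] -/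
theorem N_IUTchIII_Cor3_12_pf_xi_f_iff_soundAtPilot (G : LinkGluing P) (hfin : P.ThetaFinite) (hqpos : P.AbsLogQPos) :
    N_IUTchIII_Cor3_12_pf_xi_f (lociReadingI S pending) (obsReadingA S pending P D) ↔ SoundAtPilot P G :=
  (N_IUTchIII_Cor3_12_pf_xi_f_iff_statement S pending P D hfin hqpos).trans (soundAtPilot_iff_statement P G).symm

/-- The two LEVEL-0 vehicles agree with each other (given `ThetaFinite`; both ⟺ the typed Statement), for any algorithm and any gluing.
[folklore] -/
theorem gapGlobal_iff_soundAtPilot (A : StripAlgorithm P) (G : LinkGluing P) (hfin : P.ThetaFinite) :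
    A.GapGlobal ↔ SoundAtPilot P G :=
  (gapGlobal_iff_statement A hfin).trans (soundAtPilot_iff_statement P G).symm

/-- **THE LEVELS, SIDE BY SIDE** (one conjunction, no side taken): given `ThetaFinite` and `AbsLogQPos` — (node ↔ Statement) ∧ (node ↔ GapGlobal)
∧ (node ↔ SoundAtPilot); LEVEL 1 (`SoundAtInput`, STRONGER-THAN-PRINT) implies the node through its pilot component
(`soundAtInput_iff_statement_and_offPilot` is the cell's record; here only the consequence via the Statement is used). [claim: Mochizuki2012, status: disputed] -/
theorem xi_f_levels (A : StripAlgorithm P) (G : LinkGluing P) (hfin : P.ThetaFinite) (hqpos : P.AbsLogQPos) :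
    (N_IUTchIII_Cor3_12_pf_xi_f (lociReadingI S pending) (obsReadingA S pending P D) ↔ P.Statement) ∧
    (N_IUTchIII_Cor3_12_pf_xi_f (lociReadingI S pending) (obsReadingA S pending P D) ↔ A.GapGlobal) ∧
    (N_IUTchIII_Cor3_12_pf_xi_f (lociReadingI S pending) (obsReadingA S pending P D) ↔ SoundAtPilot P G) :=
  ⟨N_IUTchIII_Cor3_12_pf_xi_f_iff_statement S pending P D hfin hqpos,
    N_IUTchIII_Cor3_12_pf_xi_f_iff_gapGlobal S pending P D A hfin hqpos,
    N_IUTchIII_Cor3_12_pf_xi_f_iff_soundAtPilot S pending P D G hfin hqpos⟩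

end Summit.ABC.IUTFork.DAG

end
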